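import Literature.MathematicalPhysics.QuantumLattice.LatticeGaugeDLRGibbsProofs
import Literature.MathematicalPhysics.QuantumFieldTheory.LatticeGaugeShenZhuZhuProofs
import Literature.Probability.LatticeModels.GibbsSpecificationDLRProofs
import Summits.QuantumFields.YangMills.Theorems.ContractibleFibreFibreToTorusDLRLimit
import HarnessLib

/-!
# DLR states are closed under joint limits in the coupling and the state

Helper file for the registered sub-goal `kink_mem_ymGibbsMeasures_of_tendsto_coupling` (G2 of
the converse kink programme) of crux `FibreToTorus` (stmt-QuantumFields-16244), line `Sketch`,
route `ContractibleFibre`.  If `P k` is a DLR state of the lattice Yang–Mills (Wilson)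
specification `ymSpecification ρ (β_k)` on `ℤᵈ`, `β_k → β`, and `P k → μ` on all bounded
continuous functions with `μ` a probability measure, then `μ` is a DLR state at the limit
coupling `β` (Georgii 2011, Thm. 4.17, combined with the continuity of the specification in the
coupling).  The new ingredient over the fixed-coupling template
`mem_ymGibbsMeasures_of_tendsto_of_localDLR` is the **uniform continuity of the kernel averages
in the coupling**, `sup_η |γ^{β'}_Λ F (η) - γ^{β}_Λ F (η)| → 0` as `β' → β`, obtained from the
joint continuity of `(β', η) ↦ γ^{β'}_Λ F (η)` on `ℝ × (compact configuration space)`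
(Mathlib `IsCompact.mem_uniformity_of_prod`, the generalised tube lemma).
-/

noncomputable section

open MeasureTheory Filter Topology Finset
open Literature.Probability.LatticeModels (glueWith IsGibbsMeasure)
open Literature.MathematicalPhysics.QuantumLattice (LGConfig ZdEdge ymGibbsMeasures ymSpecification
  wilsonBoundaryAction continuous_wilsonBoundaryAction continuous_integral_ymSpecification
  abs_integral_ymSpecification_le integral_ymSpecification isProbabilityMeasure_ymSpecification
  normaliser_pos continuous_glueWith_prod exists_bound_of_continuous integrable_of_bound
  measurable_ymSpecification_apply)
open Literature.MathematicalPhysics.QuantumFieldTheory (haarProbability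
  isSpecification_ymSpecification_of_t2Space)

namespace Summit.QuantumFields.YangMills.Theorems.FibreToTorus

variable {d N : ℕ} {G : Type*} [Group G] [TopologicalSpace G] [IsTopologicalGroup G]
  [CompactSpace G] [MeasurableSpace G] [BorelSpace G] (ρ : G →* Matrix (Fin N) (Fin N) ℂ)

/-- **Joint continuity in the coupling and the boundary condition of the un-normalised kernel
integrals** `(β, η) ↦ ∫ F(ζ η_{Λᶜ}) e^{-β S_Λ(ζ η_{Λᶜ})} dζ` for continuous `F`: the integrand is
jointly continuous in `((β, η), ζ)` and the fibre `G^Λ` is compact (Mathlib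
`continuousOn_integral_of_compact_support`). [folklore] -/
theorem continuous_integral_glueWith_coupling [SecondCountableTopology G] (hρ : Continuous ρ)
    (Λ : Finset (ZdEdge d)) {F : LGConfig d G → ℝ} (hF : Continuous F) :
    Continuous fun p : ℝ × LGConfig d G =>
      ∫ ζ, F (glueWith Λ ζ p.2) * Real.exp (-p.1 * wilsonBoundaryAction ρ Λ (glueWith Λ ζ p.2))
        ∂(Measure.pi fun _ : ↥Λ => haarProbability G) := by
  have hg : Continuous fun q : (ℝ × LGConfig d G) × (↥Λ → G) => glueWith Λ q.2 q.1.2 :=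
    (continuous_glueWith_prod Λ).comp (continuous_fst.snd.prodMk continuous_snd)
  have hΦ : Continuous (Function.uncurry fun (p : ℝ × LGConfig d G) (ζ : ↥Λ → G) =>
      F (glueWith Λ ζ p.2) * Real.exp (-p.1 * wilsonBoundaryAction ρ Λ (glueWith Λ ζ p.2))) :=
    (hF.comp hg).mul (Real.continuous_exp.comp
      (continuous_fst.fst.neg.mul ((continuous_wilsonBoundaryAction ρ hρ Λ).comp hg)))
  have h := continuousOn_integral_of_compact_support
    (μ := Measure.pi fun _ : ↥Λ => haarProbability G) (s := Set.univ) isCompact_univ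
    hΦ.continuousOn (fun p x _ hx => absurd (Set.mem_univ x) hx)
  exact continuousOn_univ.1 h

/-- **Joint continuity of the kernel averages in the coupling and the boundary condition**: for
continuous `F`, `(β, η) ↦ ∫ F dγ^β_Λ(· | η)` is continuous on `ℝ × LGConfig d G` (ratio of the
jointly continuous un-normalised integrals, positive normaliser). [folklore] -/
theorem continuous_integral_ymSpecification_coupling [SecondCountableTopology G]
    (hρ : Continuous ρ) (Λ : Finset (ZdEdge d)) {F : LGConfig d G → ℝ} (hF : Continuous F) :
    Continuous fun p : ℝ × LGConfig d G => ∫ U, F U ∂(ymSpecification ρ p.1 Λ p.2) := by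
  have key : ∀ (β : ℝ) (η : LGConfig d G), ∫ U, F U ∂(ymSpecification ρ β Λ η) =
      (∫ ζ, F (glueWith Λ ζ η) * Real.exp (-β * wilsonBoundaryAction ρ Λ (glueWith Λ ζ η))
          ∂(Measure.pi fun _ : ↥Λ => haarProbability G)) /
        ∫ ζ, Real.exp (-β * wilsonBoundaryAction ρ Λ (glueWith Λ ζ η))
          ∂(Measure.pi fun _ : ↥Λ => haarProbability G) :=
    fun β η => integral_ymSpecification ρ hρ β Λ hF.measurable η
  simp only [key]
  refine (continuous_integral_glueWith_coupling ρ hρ Λ hF).div ?_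
    fun p => (normaliser_pos ρ hρ p.1 Λ p.2).ne'
  have h := continuous_integral_glueWith_coupling ρ hρ Λ (F := fun _ => (1 : ℝ)) continuous_const
  simpa using h

/-- **DLR states are closed under joint limits of couplings and states.** Let `β_k → β`, let
`P k ∈ 𝒢(β_k)` be DLR states of the Wilson specification at coupling `β_k`, and let `P k → μ` on
all bounded continuous functions, `μ` a probability measure.  Then `μ ∈ 𝒢(β)` (Georgii 2011,
Thm. 4.17, with the specification depending continuously on the coupling): for bounded
continuous `F`, `∫ γ^β_Λ F dμ = lim ∫ γ^β_Λ F dP_k = lim ∫ γ^{β_k}_Λ F dP_k = lim ∫ F dP_k = ∫ F dμ`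
by the Feller property, the uniform continuity of the kernel averages in the coupling and the
DLR equations at `β_k`; then `μ γ^β_Λ = μ` since bounded continuous functions separate finite
Borel measures on the compact metrisable configuration space. [folklore] -/
theorem mem_ymGibbsMeasures_of_tendsto_coupling [T2Space G] [SecondCountableTopology G]
    (hρ : Continuous ρ) {βs : ℕ → ℝ} {β : ℝ} (hβ : Tendsto βs atTop (𝓝 β))
    (P : ℕ → Measure (LGConfig d G)) (μ : Measure (LGConfig d G)) [IsProbabilityMeasure μ]
    (hP : ∀ k, P k ∈ ymGibbsMeasures ρ (βs k))
    (hlim : ∀ F : LGConfig d G → ℝ, Continuous F → (∃ C, ∀ U, |F U| ≤ C) →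
      Tendsto (fun k => ∫ U, F U ∂P k) atTop (𝓝 (∫ U, F U ∂μ))) :
    μ ∈ ymGibbsMeasures ρ β := by
  classical
  have hPk : ∀ k, IsGibbsMeasure (ymSpecification ρ (βs k)) (P k) := hP
  haveI hPprob : ∀ k, IsProbabilityMeasure (P k) := fun k => (hPk k).1
  -- Step 1: `μ(F) = μ(γ^β_Λ F)` for bounded continuous observables
  have core : ∀ (Λ : Finset (ZdEdge d)) (F : LGConfig d G → ℝ), Continuous F → ∀ C : ℝ,
      (∀ U, |F U| ≤ C) → ∫ U, F U ∂μ = ∫ η, (∫ U, F U ∂(ymSpecification ρ β Λ η)) ∂μ := by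
    intro Λ F hFc C hC
    -- the kernel averages `g β' η = γ^{β'}_Λ F (η)`
    set g : ℝ → LGConfig d G → ℝ := fun β' η => ∫ U, F U ∂(ymSpecification ρ β' Λ η) with hg
    have hgc : ∀ β', Continuous (g β') := fun β' =>
      continuous_integral_ymSpecification ρ hρ β' Λ hFc hC
    have hgb : ∀ β' η, |g β' η| ≤ C := fun β' =>
      abs_integral_ymSpecification_le ρ hρ β' Λ hC
    have hgi : ∀ β' k, Integrable (g β') (P k) := fun β' k =>
      integrable_of_bound (hgc β').aestronglyMeasurable (hgb β')
    have h1 : Tendsto (fun k => ∫ U, F U ∂P k) atTop (𝓝 (∫ U, F U ∂μ)) := hlim F hFc ⟨C, hC⟩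
    have h2 : Tendsto (fun k => ∫ η, g β η ∂P k) atTop (𝓝 (∫ η, g β η ∂μ)) :=
      hlim (g β) (hgc β) ⟨C, hgb β⟩
    -- the DLR equations at `β_k`
    have h3 : ∀ k, ∫ η, g (βs k) η ∂P k = ∫ U, F U ∂P k := fun k =>
      (hPk k).integral_integral_eq (isSpecification_ymSpecification_of_t2Space ρ hρ (βs k)) Λ
        (integrable_of_bound hFc.aestronglyMeasurable hC)
    -- uniform continuity of the kernel averages in the coupling (compact configuration space)
    have hgu : Continuous (Function.uncurry g) :=
      continuous_integral_ymSpecification_coupling ρ hρ Λ hFc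
    have hU : ∀ ε > 0, ∀ᶠ β' in 𝓝 β, ∀ η, dist (g β' η) (g β η) < ε := by
      intro ε hε
      obtain ⟨v, hv, hvε⟩ := isCompact_univ.mem_uniformity_of_prod (f := g) (s := Set.univ)
        (q := β) hgu.continuousOn (Set.mem_univ β) (Metric.dist_mem_uniformity hε)
      rw [nhdsWithin_univ] at hv
      exact Filter.mem_of_superset hv fun β' hβ' η => hvε β' hβ' η (Set.mem_univ η)
    have h4 : Tendsto (fun k => ∫ η, g (βs k) η ∂P k - ∫ η, g β η ∂P k) atTop (𝓝 0) := by
      rw [Metric.tendsto_nhds]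
      intro ε hε
      filter_upwards [hβ.eventually (hU (ε / 2) (half_pos hε))] with k hk
      rw [dist_zero_right, ← integral_sub (hgi (βs k) k) (hgi β k)]
      calc ‖∫ η, (g (βs k) η - g β η) ∂P k‖ ≤ ε / 2 * (P k).real Set.univ :=
            norm_integral_le_of_norm_le_const (ae_of_all _ fun η => by
              rw [Real.norm_eq_abs, ← Real.dist_eq]; exact (hk η).le)
        _ = ε / 2 := by simp
        _ < ε := half_lt_self hε
    have h5 : Tendsto (fun k => ∫ η, g (βs k) η ∂P k) atTop (𝓝 (∫ η, g β η ∂μ)) := by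
      have h := h4.add h2
      simp only [zero_add, sub_add_cancel] at h
      exact h
    exact tendsto_nhds_unique h1 (h5.congr fun k => h3 k)
  -- Step 2: `μ = μ γ^β_Λ` as measures, tested on bounded continuous functions
  have hκ : ∀ Λ : Finset (ZdEdge d), Measurable (ymSpecification ρ β Λ) := fun Λ =>
    Measure.measurable_of_measurable_coe _ fun s hs =>
      measurable_ymSpecification_apply ρ hρ β Λ hs
  have hμeq : ∀ Λ : Finset (ZdEdge d), μ = μ.bind (ymSpecification ρ β Λ) := by
    intro Λ
    refine ext_of_forall_lintegral_eq_of_IsFiniteMeasure fun f => ?_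
    have hfm : Measurable fun x => (f x : ENNReal) :=
      measurable_coe_nnreal_ennreal.comp f.continuous.measurable
    rw [Measure.lintegral_bind (hκ Λ).aemeasurable hfm.aemeasurable]
    have hfc : Continuous fun x => (f x : ℝ) := NNReal.continuous_coe.comp f.continuous
    have hfb : ∀ x, |(f x : ℝ)| ≤ nndist f 0 := fun x => by
      rw [abs_of_nonneg (f x).coe_nonneg]
      exact_mod_cast BoundedContinuousFunction.NNReal.upper_bound f x
    have hint : ∀ (m : Measure (LGConfig d G)) [IsFiniteMeasure m],
        ∫⁻ x, (f x : ENNReal) ∂m = ENNReal.ofReal (∫ x, (f x : ℝ) ∂m) := by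
      intro m _
      rw [← BoundedContinuousFunction.toReal_lintegral_coe_eq_integral,
        ENNReal.ofReal_toReal (BoundedContinuousFunction.lintegral_lt_top_of_nnreal m f).ne]
    have hγprob : ∀ η : LGConfig d G, IsProbabilityMeasure (ymSpecification ρ β Λ η) :=
      isProbabilityMeasure_ymSpecification ρ hρ β Λ
    have hpt : (fun η => ∫⁻ x, (f x : ENNReal) ∂(ymSpecification ρ β Λ η)) = fun η =>
        ENNReal.ofReal (∫ x, (f x : ℝ) ∂(ymSpecification ρ β Λ η)) :=
      funext fun η => hint _
    rw [hint μ, hpt, ← ofReal_integral_eq_lintegral_ofReal]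
    · rw [core Λ _ hfc _ hfb]
    · exact integrable_of_bound (continuous_integral_ymSpecification ρ hρ β Λ hfc
        hfb).aestronglyMeasurable (abs_integral_ymSpecification_le ρ hρ β Λ hfb)
    · exact ae_of_all _ fun η => integral_nonneg fun x => (f x).coe_nonneg
  -- Step 3: the DLR equations
  refine ⟨inferInstance, fun Λ A hA => ?_⟩
  calc ∫⁻ η, ymSpecification ρ β Λ η A ∂μ = (μ.bind (ymSpecification ρ β Λ)) A :=
        (Measure.bind_apply hA (hκ Λ).aemeasurable).symm
    _ = μ A := by rw [← hμeq Λ]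

/-- **Registered form (sub-goal G2 `kink_mem_ymGibbsMeasures_of_tendsto_coupling` of the converse
kink programme)** of `mem_ymGibbsMeasures_of_tendsto_coupling`: closed statement over
`d, N, G, ρ`; DLR states `P k` at couplings `β_k → β` converging on bounded continuous functions
to a probability measure `μ` have a DLR limit `μ ∈ 𝒢(β)`. [folklore] -/
theorem kink_mem_ymGibbsMeasures_of_tendsto_coupling : ∀ (d N : ℕ) (G : Type) [Group G] [TopologicalSpace G] [IsTopologicalGroup G] [CompactSpace G] [MeasurableSpace G] [BorelSpace G] [T2Space G] [SecondCountableTopology G] (ρ : G →* Matrix (Fin N) (Fin N) ℂ), Continuous ρ → ∀ (βs : ℕ → ℝ) (β : ℝ), Filter.Tendsto βs Filter.atTop (nhds β) → ∀ (P : ℕ → MeasureTheory.Measure (LGConfig d G)) (μ : MeasureTheory.Measure (LGConfig d G)), (∀ k, P k ∈ ymGibbsMeasures (d := d) ρ (βs k)) → MeasureTheory.IsProbabilityMeasure μ → (∀ F : LGConfig d G → ℝ, Continuous F → (∃ C : ℝ, ∀ U, |F U| ≤ C) → Filter.Tendsto (fun k => ∫ U, F U ∂P k) Filter.atTop (nhds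 (∫ U, F U ∂μ))) → μ ∈ ymGibbsMeasures (d := d) ρ β := by
  intro d N G _ _ _ _ _ _ _ _ ρ hρ βs β hβ P μ hP hμ hlim
  exact mem_ymGibbsMeasures_of_tendsto_coupling (d := d) ρ hρ hβ P μ hP hlim

end Summit.QuantumFields.YangMills.Theorems.FibreToTorus

end
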